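import Literature.Probability.RandomPlanarGeometry.HexSAWSurfaceWallRenewalKendall
import Literature.Probability.RandomPlanarGeometry.HexSAWSurfaceWallRenewalMean
import Literature.Probability.RandomPlanarGeometry.HexSAWSurfaceWallRateSqrtMonotone
import HarnessLib

/-!
# Kendall's rate LOCALLY UNIFORMLY in the fugacity: uniform convergence of the wall-bridge amplitudes and continuity of `m(y)`

Lane pcv-sawmu, a-idea-1 gen 29, car 51 «KENDALL-UNIFORM». CLASS D on `HexSAWSurfaceWallRenewalKendall` (car 48: the
tail envelope `one_sub_sum_pwbLaw_le` and, through it, car 47's model-free Kendall theorem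
`Renewal.kendall_abs_sub_inv_le_of_geometric`), on `HexSAWSurfaceWallRenewalMean` (car 39: the atom bound
`div_sq_wallRate_le_pwbLaw_one`, `y/β(y)² ≤ f_1(y)`) and on the tree's `HexSAWSurfaceWallRateSqrtMonotone`
(`wallRate_le_sqrt_mul`: `y ↦ β(y)/√y` is non-increasing; `continuousAt_wallRate`).

Setting (tree, `HexSAWSurfaceWallRenewal`): `u_s(y) = pwbAmp y s = PWB_{2s}(y) β(y)^{-2s}` solves the renewal
equation with irreducible law `f_s(y) = pwbLaw y s`; for `y > μ⁴`, `Σ_s f_s(y) = 1`, `m(y) = pwbMean y`,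
`u_s(y) → 1/m(y)` (`tendsto_pwbAmp`), with a geometric rate for each fixed `y` (car 48,
`exists_geometric_rate_pwbAmp`). THIS FILE makes the rate UNIFORM on every closed half-line `[y₀, ∞)`,
`y₀ > μ⁴`, with ONE radius and ONE constant depending on `y₀` only — because every datum of Kendall's theorem is
monotone in the fugacity:
* the envelope ratio `θ(y) = μ²/√y` and the constant `A(y) = μ⁴/(1 − θ(y))` DEcrease in `y`, so the tail bound
  `r_n(y) ≤ A(y) θ(y)ⁿ ≤ A(y₀) θ(y₀)ⁿ` holds with the `y₀`-data for all `y ≥ y₀` (`one_sub_sum_pwbLaw_le_of_le`);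
* the atom `f_1(y) = IPWB_2(y)/β(y)² ≥ y/β(y)²` INcreases in `y` (`div_sq_wallRate_mono`, from `β(y)/√y`
  non-increasing), so `f_1(y) ≥ y₀/β(y₀)² =: b₀ > 0` for all `y ≥ y₀` (`div_sq_wallRate_le_pwbLaw_one_of_le`).
Consequences: ★ `abs_pwbAmp_sub_inv_pwbMean_le_kendall_of_le` (explicit, `y₀`-data only),
★ `exists_uniform_geometric_rate_pwbAmp` (`∃ ρ > 1, ∃ K, ∀ y ≥ y₀, ∀ s, |u_s(y) − 1/m(y)| ≤ K ρ^{-s}`),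
★ `tendstoUniformlyOn_pwbAmp` (uniform convergence of the amplitudes on `[y₀, ∞)`), and — uniform limits of
continuous functions being continuous — ★ `continuousOn_inv_pwbMean`, `continuousOn_pwbMean`: the mean renewal
time `m(y)` (the inverse amplitude of `PWB_{2s}(y) ≈ β(y)^{2s}/m(y)`) is CONTINUOUS on the whole adsorbed phase
`(μ⁴, ∞)`. (Continuity of `m` alone is also available softly, by the M-test on the envelope; the uniform
convergence of the renewal SOLUTION `u_s(y)` is the statement that uses the rate.)

Primary sources: [cite: MadrasSlade1993, §4.2 Theorem 4.2.2(b) (pp. 91–92), Theorem 4.2.5 (p. 95)] —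
the renewal scheme and rate for bridge decompositions; [cite: Bednorz2013, §2, Corollary 2.5 (p. 5)] — the quantitative
Kendall theorem (constants explicit in the data `(b, A, θ)`, whence uniformity over families with common data);
[cite: Feller1968, XIII.3 and XIII.10]; [cite: BeatonBousquetMelouDeGierDuminilCopinGuttmann2014, §3.1,
Proposition 5 (arXiv v5 p. 9)] — `β(y)` non-decreasing and continuous, `β(y)/√y` non-increasing.
-/

noncomputable section

open Finset Filter
open _root_.Topology

namespace Literature.Probability.RandomPlanarGeometry.SAW.HexBW.Wall

variable {y y₀ : ℝ}

/-- [folklore] `μ⁴ < y` forces `0 < y` (`1 < μ`). [cite: MadrasSlade1993, §1.2 (1.2.16) (p. 11)] -/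
private theorem pos_of_mu_four_lt_ku (hy : hexConnectiveConstant ^ 4 < y) : 0 < y := by
  have h1 : (1 : ℝ) ≤ hexConnectiveConstant ^ 4 := one_le_pow₀ HV.one_lt_hexConnectiveConstant.le
  linarith

/-- [folklore] `0 < θ(y) = μ²/√y < 1` for `μ⁴ < y`. [cite: MadrasSlade1993, §4.2, remark before (4.2.21) (p. 94)] -/
private theorem theta_pos_lt_one_ku (hy : hexConnectiveConstant ^ 4 < y) :
    0 < hexConnectiveConstant ^ 2 / Real.sqrt y ∧ hexConnectiveConstant ^ 2 / Real.sqrt y < 1 := by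
  have hy0 := pos_of_mu_four_lt_ku hy
  have hμ := hexConnectiveConstant_pos
  refine ⟨div_pos (pow_pos hμ 2) (Real.sqrt_pos.2 hy0), ?_⟩
  rw [div_lt_one (Real.sqrt_pos.2 hy0), Real.lt_sqrt (by positivity)]
  calc (hexConnectiveConstant ^ 2) ^ 2 = hexConnectiveConstant ^ 4 := by ring
    _ < y := hy

/-! ### The atom `f_1(y) ≥ y/β(y)²` (car 39, `div_sq_wallRate_le_pwbLaw_one`) is increasing in `y` -/

/-- **`y ↦ y/β(y)²` is non-decreasing on `(0, ∞)`** — the square of the tree's `β(y')/√y' ≤ β(y)/√y` for `y ≤ y'`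
(`wallRate_le_sqrt_mul`). [cite: BeatonBousquetMelouDeGierDuminilCopinGuttmann2014, §3.1, Proposition 5 (arXiv v5 p. 9)] -/
theorem div_sq_wallRate_mono (hy₀ : 0 < y₀) (h : y₀ ≤ y) : y₀ / wallRate y₀ ^ 2 ≤ y / wallRate y ^ 2 := by
  have hy : 0 < y := hy₀.trans_le h
  have hβ := wallRate_pos y
  have hβ₀ := wallRate_pos y₀
  have h1 := wallRate_le_sqrt_mul hy₀ h
  have h2 : wallRate y ^ 2 ≤ y / y₀ * wallRate y₀ ^ 2 := by
    calc wallRate y ^ 2 ≤ (Real.sqrt (y / y₀) * wallRate y₀) ^ 2 := pow_le_pow_left₀ hβ.le h1 2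
      _ = y / y₀ * wallRate y₀ ^ 2 := by rw [mul_pow, Real.sq_sqrt (div_nonneg hy.le hy₀.le)]
  rw [div_le_div_iff₀ (pow_pos hβ₀ 2) (pow_pos hβ 2)]
  calc y₀ * wallRate y ^ 2 ≤ y₀ * (y / y₀ * wallRate y₀ ^ 2) := mul_le_mul_of_nonneg_left h2 hy₀.le
    _ = y * wallRate y₀ ^ 2 := by field_simp

/-- The atom bounded below UNIFORMLY on `[y₀, ∞)`: `b₀ = y₀/β(y₀)² ≤ f_1(y)` for `0 < y₀ ≤ y`.
[cite: BeatonBousquetMelouDeGierDuminilCopinGuttmann2014, §3.1, Proposition 5 (arXiv v5 p. 9)] [cite: MadrasSlade1993, §4.2 (p. 90)] -/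
theorem div_sq_wallRate_le_pwbLaw_one_of_le (hy₀ : 0 < y₀) (h : y₀ ≤ y) : y₀ / wallRate y₀ ^ 2 ≤ pwbLaw y 1 :=
  (div_sq_wallRate_mono hy₀ h).trans (div_sq_wallRate_le_pwbLaw_one (hy₀.trans_le h))

/-! ### The tail envelope with the `y₀`-data, for every `y ≥ y₀` -/

/-- **Uniform tail envelope**: for `μ⁴ < y₀ ≤ y` and every `n`,
`r_n(y) = 1 − Σ_{k ≤ n} f_k(y) ≤ A(y₀) θ(y₀)ⁿ` with `θ(y₀) = μ²/√y₀`, `A(y₀) = μ⁴/(1 − θ(y₀))` — since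
`θ(y) ≤ θ(y₀)` and `A(y) ≤ A(y₀)`. [cite: MadrasSlade1993, §4.2, remark before (4.2.21) (p. 94)] [cite: Feller1968, XIII.3] -/
theorem one_sub_sum_pwbLaw_le_of_le (hy₀ : hexConnectiveConstant ^ 4 < y₀) (h : y₀ ≤ y) (n : ℕ) :
    1 - ∑ k ∈ range (n + 1), pwbLaw y k ≤
      hexConnectiveConstant ^ 4 / (1 - hexConnectiveConstant ^ 2 / Real.sqrt y₀) *
        (hexConnectiveConstant ^ 2 / Real.sqrt y₀) ^ n := by
  have hy : hexConnectiveConstant ^ 4 < y := hy₀.trans_le h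
  have hy₀0 := pos_of_mu_four_lt_ku hy₀
  obtain ⟨hθ₀0, hθ₀1⟩ := theta_pos_lt_one_ku hy₀
  obtain ⟨hθ0, hθ1⟩ := theta_pos_lt_one_ku hy
  set θ₀ := hexConnectiveConstant ^ 2 / Real.sqrt y₀ with hθ₀
  set θ := hexConnectiveConstant ^ 2 / Real.sqrt y with hθ
  have hθθ₀ : θ ≤ θ₀ := by
    rw [hθ, hθ₀]
    exact div_le_div_of_nonneg_left (pow_nonneg hexConnectiveConstant_pos.le 2) (Real.sqrt_pos.2 hy₀0)
      (Real.sqrt_le_sqrt h)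
  have hμ4 : 0 ≤ hexConnectiveConstant ^ 4 := pow_nonneg hexConnectiveConstant_pos.le 4
  calc 1 - ∑ k ∈ range (n + 1), pwbLaw y k ≤ hexConnectiveConstant ^ 4 / (1 - θ) * θ ^ n :=
        one_sub_sum_pwbLaw_le hy n
    _ ≤ hexConnectiveConstant ^ 4 / (1 - θ₀) * θ₀ ^ n := by
        have h1 : hexConnectiveConstant ^ 4 / (1 - θ) ≤ hexConnectiveConstant ^ 4 / (1 - θ₀) :=
          div_le_div_of_nonneg_left hμ4 (by linarith) (by linarith)
        exact mul_le_mul h1 (pow_le_pow_left₀ hθ0.le hθθ₀ n) (pow_nonneg hθ0.le n)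
          (div_nonneg hμ4 (by linarith))

/-! ### Kendall's rate with `y₀`-data only -/

/-- **Kendall's rate for adsorbed wall bridges, UNIFORM on `[y₀, ∞)`** (explicit form): with the `y₀`-data
`θ₀ = μ²/√y₀`, `A₀ = μ⁴/(1 − θ₀)`, `b₀ = y₀/β(y₀)²` and any radius `ρ` with `1 < ρ`, `ρθ₀ < 1` and the margin
inequality `A₀(ρθ₀/(1−ρθ₀) − θ₀/(1−θ₀)) < b₀/(b₀ + 2A₀θ₀/(1−θ₀)²)`, EVERY `y ≥ y₀` satisfies
`|u_s(y) − 1/m(y)| ≤ ρ^{-s} / ((b₀/(b₀ + 2A₀θ₀/(1−θ₀)²) − A₀(ρθ₀/(1−ρθ₀) − θ₀/(1−θ₀))) (ρ − 1))` for all `s` — the same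
radius and constant for the whole half-line. [cite: Bednorz2013, §2, Corollary 2.5 (p. 5)]
[cite: MadrasSlade1993, §4.2 Theorem 4.2.5 (p. 95)] [cite: Feller1968, XIII.10] -/
theorem abs_pwbAmp_sub_inv_pwbMean_le_kendall_of_le (hy₀ : hexConnectiveConstant ^ 4 < y₀) (h : y₀ ≤ y)
    {θ₀ A₀ b₀ ρ : ℝ} (hθ : θ₀ = hexConnectiveConstant ^ 2 / Real.sqrt y₀)
    (hA : A₀ = hexConnectiveConstant ^ 4 / (1 - θ₀)) (hb : b₀ = y₀ / wallRate y₀ ^ 2)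
    (hρ : 1 < ρ) (hρθ : ρ * θ₀ < 1)
    (hc : A₀ * (ρ * θ₀ / (1 - ρ * θ₀) - θ₀ / (1 - θ₀)) < b₀ / (b₀ + 2 * (A₀ * θ₀ / (1 - θ₀) ^ 2))) (s : ℕ) :
    |pwbAmp y s - (pwbMean y)⁻¹| ≤
      ρ⁻¹ ^ s / ((b₀ / (b₀ + 2 * (A₀ * θ₀ / (1 - θ₀) ^ 2)) - A₀ * (ρ * θ₀ / (1 - ρ * θ₀) - θ₀ / (1 - θ₀))) * (ρ - 1)) := by
  have hy : hexConnectiveConstant ^ 4 < y := hy₀.trans_le h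
  have hy₀0 := pos_of_mu_four_lt_ku hy₀
  have hy0 := pos_of_mu_four_lt_ku hy
  obtain ⟨hθ₀0, _⟩ := theta_pos_lt_one_ku hy₀
  rw [← hθ] at hθ₀0
  have hb0 : 0 < b₀ := by rw [hb]; exact div_pos hy₀0 (pow_pos (wallRate_pos y₀) 2)
  have hb1 : b₀ ≤ pwbLaw y 1 := by rw [hb]; exact div_sq_wallRate_le_pwbLaw_one_of_le hy₀0 h
  have htail : ∀ j : ℕ, 1 ≤ j → 1 - ∑ k ∈ range (j + 1), pwbLaw y k ≤ A₀ * θ₀ ^ j := by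
    intro j _
    have h1 := one_sub_sum_pwbLaw_le_of_le hy₀ h j
    rw [← hθ, ← hA] at h1
    exact h1
  have h1 := Literature.Probability.Process.Renewal.kendall_abs_sub_inv_le_of_geometric
    (u := pwbAmp y) (f := pwbLaw y) (r := fun n => 1 - ∑ k ∈ range (n + 1), pwbLaw y k) (fun _ => rfl)
    pwbAmp_zero (pwbLaw_nonneg hy0.le) pwbLaw_zero (fun n hn => pwbAmp_eq_sum hn) (hasSum_pwbLaw hy)
    (summable_mul_pwbLaw hy) hb0 hb1 hθ₀0 hρ hρθ htail hc s
  simpa only [pwbMean] using h1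

/-- **A geometric rate UNIFORM IN THE FUGACITY on `[y₀, ∞)`, for every `y₀ > μ⁴`**: there are `ρ > 1` and `K`,
depending on `y₀` only, with `|PWB_{2s}(y) β(y)^{-2s} − 1/m(y)| ≤ K ρ^{-s}` for ALL `y ≥ y₀` and all `s`. The radius
is exhibited as in car 48 but from the `y₀`-data `(b₀, A₀, θ₀)`: `ρ = (1 + ρ₀)/2`, `ρ₀ = t/((1+t)θ₀)`,
`t = θ₀/(1−θ₀) + c₀/A₀`, `c₀ = b₀/(b₀ + 2A₀θ₀/(1−θ₀)²)`. [cite: Bednorz2013, §2, Corollary 2.5 (p. 5)]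
[cite: MadrasSlade1993, §4.2 Theorem 4.2.5 (p. 95)] [cite: Feller1968, XIII.10] -/
theorem exists_uniform_geometric_rate_pwbAmp (hy₀ : hexConnectiveConstant ^ 4 < y₀) :
    ∃ ρ : ℝ, 1 < ρ ∧ ∃ K : ℝ, ∀ y : ℝ, y₀ ≤ y → ∀ s : ℕ, |pwbAmp y s - (pwbMean y)⁻¹| ≤ K * ρ⁻¹ ^ s := by
  have hy₀0 := pos_of_mu_four_lt_ku hy₀
  obtain ⟨hθ0, hθ1⟩ := theta_pos_lt_one_ku hy₀
  set θ := hexConnectiveConstant ^ 2 / Real.sqrt y₀ with hθ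
  set A := hexConnectiveConstant ^ 4 / (1 - θ) with hA
  set b := y₀ / wallRate y₀ ^ 2 with hb
  set M := A * θ / (1 - θ) ^ 2 with hM
  set c := b / (b + 2 * M) with hc
  have hb0 : 0 < b := div_pos hy₀0 (pow_pos (wallRate_pos y₀) 2)
  have h1θ : 0 < 1 - θ := by linarith
  have hA0 : 0 < A := div_pos (pow_pos hexConnectiveConstant_pos 4) h1θ
  have hM0 : 0 ≤ M := by positivity
  have hc0 : 0 < c := by positivity
  set t := θ / (1 - θ) + c / A with ht
  have ht0 : θ / (1 - θ) < t := by have := div_pos hc0 hA0; linarith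
  have htpos : 0 < t := lt_trans (div_pos hθ0 h1θ) ht0
  have hθt : θ < t / (1 + t) := by
    rw [lt_div_iff₀ (by linarith)]
    have h := (div_lt_iff₀ h1θ).1 ht0
    nlinarith
  set ρ₀ := t / ((1 + t) * θ) with hρ₀
  have hρ₀1 : 1 < ρ₀ := by
    rw [hρ₀, lt_div_iff₀ (by positivity), one_mul]
    calc (1 + t) * θ < (1 + t) * (t / (1 + t)) := mul_lt_mul_of_pos_left hθt (by linarith)
      _ = t := by field_simp
  set ρ := (1 + ρ₀) / 2 with hρ
  have hρ1 : 1 < ρ := by rw [hρ]; linarith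
  have hρρ₀ : ρ < ρ₀ := by rw [hρ]; linarith
  have hρθ' : ρ * θ < t / (1 + t) := by
    calc ρ * θ < ρ₀ * θ := mul_lt_mul_of_pos_right hρρ₀ hθ0
      _ = t / (1 + t) := by rw [hρ₀]; field_simp
  have hρθ : ρ * θ < 1 := hρθ'.trans (by rw [div_lt_one (by linarith)]; linarith)
  have hmargin : A * (ρ * θ / (1 - ρ * θ) - θ / (1 - θ)) < c := by
    have h1 : ρ * θ / (1 - ρ * θ) < t := by
      rw [div_lt_iff₀ (by linarith)]
      have h2 := (lt_div_iff₀ (show (0 : ℝ) < 1 + t by linarith)).1 hρθ'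
      nlinarith
    have h3 : ρ * θ / (1 - ρ * θ) - θ / (1 - θ) < c / A := by rw [ht] at h1; linarith
    calc A * (ρ * θ / (1 - ρ * θ) - θ / (1 - θ)) < A * (c / A) := mul_lt_mul_of_pos_left h3 hA0
      _ = c := by field_simp
  refine ⟨ρ, hρ1, 1 / ((c - A * (ρ * θ / (1 - ρ * θ) - θ / (1 - θ))) * (ρ - 1)), fun y hy s => ?_⟩
  have h := abs_pwbAmp_sub_inv_pwbMean_le_kendall_of_le hy₀ hy hθ hA hb hρ1 hρθ
    (by rw [← hM, ← hc]; exact hmargin) s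
  rw [← hM, ← hc] at h
  calc |pwbAmp y s - (pwbMean y)⁻¹| ≤ ρ⁻¹ ^ s / ((c - A * (ρ * θ / (1 - ρ * θ) - θ / (1 - θ))) * (ρ - 1)) := h
    _ = 1 / ((c - A * (ρ * θ / (1 - ρ * θ) - θ / (1 - θ))) * (ρ - 1)) * ρ⁻¹ ^ s := by ring

/-- The uniform rate in the partition-function spelling `PWB (2s) y / β(y)^{2s}`.
[cite: MadrasSlade1993, §4.2 Theorem 4.2.5 (p. 95)] [cite: Bednorz2013, §2, Corollary 2.5 (p. 5)] -/
theorem exists_uniform_geometric_rate_PWB_div (hy₀ : hexConnectiveConstant ^ 4 < y₀) :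
    ∃ ρ : ℝ, 1 < ρ ∧ ∃ K : ℝ, ∀ y : ℝ, y₀ ≤ y → ∀ s : ℕ,
      |PWB (2 * s) y / wallRate y ^ (2 * s) - (pwbMean y)⁻¹| ≤ K * ρ⁻¹ ^ s :=
  exists_uniform_geometric_rate_pwbAmp hy₀

/-! ### Uniform convergence of the amplitudes and continuity of the mean renewal time -/

/-- **The renewal limit is attained UNIFORMLY in the fugacity on `[y₀, ∞)`** (`y₀ > μ⁴`):
`u_s(y) = PWB_{2s}(y) β(y)^{-2s} → 1/m(y)` uniformly for `y ∈ [y₀, ∞)` — the rate-free `tendsto_pwbAmp` made uniform by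
Kendall's explicit constants. [cite: Bednorz2013, §2, Corollary 2.5 (p. 5)] [cite: MadrasSlade1993, §4.2 Theorem 4.2.5 (p. 95)] -/
theorem tendstoUniformlyOn_pwbAmp (hy₀ : hexConnectiveConstant ^ 4 < y₀) :
    TendstoUniformlyOn (fun s y => pwbAmp y s) (fun y => (pwbMean y)⁻¹) atTop (Set.Ici y₀) := by
  obtain ⟨ρ, hρ1, K, hK⟩ := exists_uniform_geometric_rate_pwbAmp hy₀
  have hρ0 : 0 ≤ ρ⁻¹ := inv_nonneg.2 (by linarith)
  have hρi : ρ⁻¹ < 1 := inv_lt_one_of_one_lt₀ hρ1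
  have h0 : Tendsto (fun s : ℕ => K * ρ⁻¹ ^ s) atTop (𝓝 0) := by
    simpa using (tendsto_pow_atTop_nhds_zero_of_lt_one hρ0 hρi).const_mul K
  rw [Metric.tendstoUniformlyOn_iff]
  intro ε hε
  filter_upwards [(tendsto_order.1 h0).2 ε hε] with s hs y hy
  rw [Real.dist_eq, abs_sub_comm]
  exact (hK y hy s).trans_lt hs

/-- Each amplitude `y ↦ u_s(y) = PWB_{2s}(y)/β(y)^{2s}` is continuous on `(0, ∞)` (`PWB_{2s}` is a polynomial in `y`,
`β` is continuous and positive). [cite: BeatonBousquetMelouDeGierDuminilCopinGuttmann2014, §3.1, Proposition 5 (arXiv v5 p. 9: "and therefore continuous")] -/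
theorem continuousOn_pwbAmp (s : ℕ) : ContinuousOn (fun y : ℝ => pwbAmp y s) (Set.Ioi 0) := by
  have hP : Continuous fun y : ℝ => PWB (2 * s) y := by
    unfold PWB
    exact continuous_finsetSum _ fun ω _ => continuous_pow _ |>.comp continuous_id
  have hβ : ContinuousOn (fun y : ℝ => wallRate y ^ (2 * s)) (Set.Ioi 0) := continuousOn_wallRate.pow _
  exact hP.continuousOn.div hβ fun y _ => pow_ne_zero _ (wallRate_pos y).ne'

/-- **The amplitude `1/m(y)` is continuous on the adsorbed phase `(μ⁴, ∞)`** — a uniform limit (on every `[y₀, ∞)`,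
`y₀ > μ⁴`) of continuous functions. [cite: Bednorz2013, §2, Corollary 2.5 (p. 5)]
[cite: BeatonBousquetMelouDeGierDuminilCopinGuttmann2014, §3.1, Proposition 5 (arXiv v5 p. 9)] -/
theorem continuousOn_inv_pwbMean :
    ContinuousOn (fun y : ℝ => (pwbMean y)⁻¹) (Set.Ioi (hexConnectiveConstant ^ 4)) := by
  intro y₁ hy₁
  -- a half-line `[y₀, ∞)` with `μ⁴ < y₀ < y₁` is a neighbourhood of `y₁`
  set y₀ := (hexConnectiveConstant ^ 4 + y₁) / 2 with hy₀
  have hμy₀ : hexConnectiveConstant ^ 4 < y₀ := by rw [hy₀]; linarith [Set.mem_Ioi.1 hy₁]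
  have hy₀y₁ : y₀ < y₁ := by rw [hy₀]; linarith [Set.mem_Ioi.1 hy₁]
  have hy₀0 := pos_of_mu_four_lt_ku hμy₀
  have hcont : ContinuousOn (fun y : ℝ => (pwbMean y)⁻¹) (Set.Ici y₀) :=
    (tendstoUniformlyOn_pwbAmp hμy₀).continuousOn
      (Eventually.of_forall fun s => (continuousOn_pwbAmp s).mono fun y hy =>
        Set.mem_Ioi.2 (hy₀0.trans_le (Set.mem_Ici.1 hy))).frequently
  have hnhds : Set.Ici y₀ ∈ 𝓝 y₁ := Ici_mem_nhds hy₀y₁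
  exact (hcont.continuousAt hnhds).continuousWithinAt

/-- **The mean renewal time `m(y)` of the adsorbed wall-bridge law is continuous on `(μ⁴, ∞)`.**
[cite: Bednorz2013, §2, Corollary 2.5 (p. 5)] [cite: BeatonBousquetMelouDeGierDuminilCopinGuttmann2014, §3.1, Proposition 5 (arXiv v5 p. 9)] -/
theorem continuousOn_pwbMean : ContinuousOn pwbMean (Set.Ioi (hexConnectiveConstant ^ 4)) := by
  have h := continuousOn_inv_pwbMean.inv₀ fun y hy => (inv_pos.2 (pwbMean_pos (Set.mem_Ioi.1 hy))).ne'
  refine h.congr fun y hy => ?_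
  simp

end Literature.Probability.RandomPlanarGeometry.SAW.HexBW.Wall

end
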